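import Mathlib
import Literature.Combinatorics.Optimization.PseudoDensityFourier
import Literature.Computability.Complexity.FourierDegreeAlgebra
import HarnessLib

/-!
# Sum-of-squares degree UPPER bounds on the hypercube: Laurent's conjecture
# (Fawzi–Saunderson–Parrilo 2016, Thm 2) and the Sakaue–Takeda–Kim–Ito bound `⌈(n+r−1)/2⌉`

Topic `Literature/Combinatorics/Optimization`; companion of `KnapsackQuadraticSosDegree.lean` (the
LOWER bounds: Grigoriev / Lee–Raghavendra–Steurer Thm 1.12) in the same currency
(`PatternMatrixPsdRank.lean`: `HasDegreeLE k g` = "`g` agrees on `{0,1}^m` with a real polynomial of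
total degree `≤ k`", `HasSosCertificate d f` = "`f = Σ_i g_i²` on `{0,1}^m` with all
`deg g_i ≤ d/2`").  Everything here is PROVED; no named facts.

**The theorems.**

* `hasSosCertificate_of_even_quadratic` — **Fawzi–Saunderson–Parrilo, Math. Program. 160 (2016),
  Theorem 2** ("Any nonnegative quadratic function on `{−1,1}^n` is a sum-of-squares of polynomials of
  degree at most `⌈n/2⌉`", Laurent's 2003 conjecture; their "quadratic function" is one with Fourier
  support `{S : |S| = 0 or |S| = 2}`, p. 14, i.e. a quadratic FORM in the `±1` coordinates): for
  `f : {0,1}^m → ℝ` with `f ≥ 0` and `f̂(S) = 0` unless `|S| ∈ {0, 2}`, `HasSosCertificate (2⌈m/2⌉) f`.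
* `hasSosCertificate_of_nonneg_of_hasDegreeLE` — **Sakaue–Takeda–Kim–Ito, SIAM J. Optim. 27 (2017)**
  (as quoted verbatim in Kurpisz–Leppänen–Mastrolilli 2016, §1 p. 3 / §3 p. 6: "the SoS hierarchy
  requires at most `⌈(n+r−1)/2⌉` rounds to find the exact optimal value of an unconstrained BPOP of
  degree `r` with `n` variables", and in Kurpisz, ICALP 2019, Thm 4: "Every `n`-variate polynomial of
  degree `r`, nonnegative over the unconstrained boolean hypercube has a degree `⌈(n+r−1)/2⌉` SoS
  certificate"): `deg f ≤ r`, `f ≥ 0` on `{0,1}^m` ⟹ `HasSosCertificate (2⌈(m+r−1)/2⌉) f`.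
  For `r = 2` this is `⌈(m+1)/2⌉ = ⌊m/2⌋ + 1` (`hasSosCertificate_of_nonneg_quadratic`), one more than
  FSP's bound for forms when `m` is even and equal to it when `m` is odd (KLM16 p. 3).
* Part IV, the RELAXATION form in which both sources phrase it ("the `⌈n/2⌉` level of the Lasserre
  hierarchy for the cut polytope is exact", FSP16 p. 4; "the SoS hierarchy requires at most `⌈(n+r−1)/2⌉`
  rounds to find the exact optimal value", KLM16 p. 3): every pseudo-density `D` of the stated degree
  (`IsPseudoDensity`, LRS §2 = the Lasserre relaxation) has `E[D f] ≥ c` whenever `f ≥ c` on the cube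
  (`IsPseudoDensity.le_cubeExpect_mul_of_hasDegreeLE`, `…_of_even_quadratic`), and point masses attain
  `min f` (`isPseudoDensity_pointMass`).
* Part V, MATRIX-VALUED (our reading; the sources are scalar): the same mechanism with an extra index
  gives, for a pointwise positive-semidefinite `F : {0,1}^m → ℝ^{r×r}` with entries of degree `≤ d`
  (resp. with Fourier support in `{|S| ∈ {0,2}}`), a GRAM factorisation `F = G Gᵀ` on the cube with all
  entries of `G` of degree `≤ ⌈(m+d−1)/2⌉` (resp. `≤ ⌈m/2⌉`), uniformly in `r`
  (`CubeSos.gramFactorization_of_bandedLevels`, `gramFactorization_of_psd_of_hasDegreeLE`,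
  `gramFactorization_of_psd_even_quadratic`).

**The proof** (Fawzi–Saunderson–Parrilo's mechanism, §3 Thm 1 + §4 Prop. 6 / App. B of
arXiv:1503.01207, made elementary; the band version for degree `r` is the same mechanism with the
chordal cover "consecutive blocks of `r` sizes", which is how we read Sakaue et al.'s extension — their
text is not held, see References).  For `f ≥ 0` the Gram vectors `u_S := √f · χ_S ∈ ℝ^{2^m}`
(`χ_S = walsh S`) satisfy `⟨u_S, u_T⟩ = 2^m f̂(S ∆ T)` (`inner_sqrt_mul_walsh`), so `u_S ⟂ u_T` as soon as
`||S| − |T||` exceeds the degree of `f`; grouping the sizes into consecutive BANDS (levels) makes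
vectors two or more levels apart orthogonal.  `gram_peel` (orthogonal projection onto the span of the
lowest level, then induction — the positive-semidefinite completion along a path of cliques) splits the
Gram matrix as `Σ_j G_j` with `G_j ⪰ 0` supported on levels `{j, j+1}`; reading each `G_j` in
coordinates gives squares of functions `Σ_S a_S χ_S` supported on two consecutive levels, and
multiplying such a square by `χ_R² = 1` for `R = ∅`, `[m]` or `[m] ∖ {pt}` translates its support into
`{|S| ≤ D}` (`hasSosCertificate_of_bandedLevels`, the engine; the translations are FSP's App. B
choices `S_k = ∅, [n], φ([n])`).  The reconstruction `Σ_{S,T ∈ 𝒱} χ_S χ_T f̂(S ∆ T) = |𝒱| · f` holds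
for `𝒱 =` all sets, and for `𝒱 =` one parity class when `f̂` lives on even sets (FSP's two connected
components of the half-cube graph, §4.2).

**Not treated here**: Sakaue et al.'s refinement `⌈(m+r−2)/2⌉` for `f` with only even-degree
monomials and `r ≥ 4` (same engine, parity class + bands of width `r/2`; `r = 2` is FSP's theorem
above); tightness (Kurpisz–Leppänen–Mastrolilli 2016: for odd `m` and even `r` the bound is attained by
falling factorials — the case `r = 2` is `KnapsackQuadraticSosDegree.lean`).

## References

* [FawziSaundersonParrilo2016] H. Fawzi, J. Saunderson, P. A. Parrilo, *Sparse sums of squares on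
  finite abelian groups and improved semidefinite lifts*, Math. Program. 160 (2016) 149–191,
  arXiv:1503.01207 — Thm 2 (p. 3), Thm 1 / Thm 4 (§3, chordal covers with Fourier support), §4.2–4.3
  Prop. 6 (p. 14) and its proof App. B (pp. 21–22).  Held text `paper:arxiv-1503.01207`, read.
* [SakaueEtAl2017] S. Sakaue, A. Takeda, S. Kim, N. Ito, *Exact semidefinite programming
  relaxations with truncated moment matrix for binary polynomial optimization problems*, SIAM J. Optim.
  27 (2017) 565–582, doi:10.1137/16m105544x — NOT HELD (paywalled; acquisition request acq-13747);
  statement taken from the two verbatim quotations below.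
* [KurpiszLeppanenMastrolilli2016] A. Kurpisz, S. Leppänen, M. Mastrolilli, *Tight sum-of-squares
  lower bounds for binary polynomial optimization problems*, ICALP 2016, arXiv:1605.03019 — §1 p. 3 and
  §3 p. 6 (quotation of the Sakaue–Takeda–Kim–Ito bound; tightness).  Held, read.
* [Kurpisz2019] A. Kurpisz, *Sum-of-squares bounds via Boolean function analysis*, ICALP 2019,
  LIPIcs 132:79 — Thm 4 (p. 79:4, quotation of the Sakaue–Takeda–Kim–Ito bound).  Held, read.
* [Laurent2003] M. Laurent, *Lower bound for the number of iterations in semidefinite hierarchies for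
  the cut polytope*, Math. Oper. Res. 28 (2003) — the conjecture.
-/

noncomputable section

open Finset Matrix
open scoped InnerProductSpace symmDiff MatrixOrder
open Literature.Probability.RandomGraphs.LowDegree (walsh sgn sgn_mul_self walsh_empty)
open Literature.Computability.Complexity.LowDegree (cubeFourierCoeff sum_cubeFourierCoeff_mul_walsh
  walsh_mul_walsh)

namespace Literature.Combinatorics.Optimization

namespace CubeSos

/-! ### Part I.a — Gram peeling along a banded level structure (linear algebra) -/

section Peel

variable {V E : Type*} [NormedAddCommGroup E] [InnerProductSpace ℝ E] [FiniteDimensional ℝ E]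

/-- Induction form of `gram_peel`: vectors vanishing below level `k` are peeled from level `k` on.
[cite: FawziSaundersonParrilo2016, Thm 4 / §3 (psd completion along a chordal cover), App. B] -/
private theorem gram_peel_aux (ℓ : V → ℕ) (L : ℕ) (hL : ∀ v, ℓ v ≤ L) :
    ∀ (d k : ℕ), k + d = L + 1 →
    ∀ (u : V → E), (∀ v, ℓ v < k → u v = 0) →
      (∀ v w, ℓ v + 2 ≤ ℓ w → ⟪u v, u w⟫_ℝ = 0) →
      ∃ p : ℕ → V → E,
        (∀ j v, p j v ≠ 0 → k ≤ j ∧ (ℓ v = j ∨ ℓ v = j + 1)) ∧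
        ∀ v w, ⟪u v, u w⟫_ℝ = ∑ j ∈ range (L + 1), ⟪p j v, p j w⟫_ℝ := by
  intro d
  induction d with
  | zero =>
    intro k hk u hu _
    refine ⟨fun _ _ => 0, fun j v h => (h rfl).elim, fun v w => ?_⟩
    have hv : u v = 0 := hu v (by have := hL v; omega)
    simp [hv]
  | succ d ih =>
    intro k hk u hu hband
    -- the span of the level-`k` vectors and the orthogonal projection onto it
    let W : Submodule ℝ E := Submodule.span ℝ (Set.range fun v : {v // ℓ v = k} => u v.1)
    let P := W.starProjection
    have hmemW : ∀ v, ℓ v = k → u v ∈ W := fun v hv =>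
      Submodule.subset_span ⟨⟨v, hv⟩, rfl⟩
    have horth : ∀ w, k + 2 ≤ ℓ w → u w ∈ Wᗮ := by
      intro w hw
      rw [Submodule.mem_orthogonal]
      intro z hz
      refine Submodule.span_induction ?_ ?_ ?_ ?_ hz
      · rintro _ ⟨⟨v, hv⟩, rfl⟩
        exact hband v w (by omega)
      · simp
      · intro a b _ _ ha hb; rw [inner_add_left, ha, hb, add_zero]
      · intro c a _ ha; rw [inner_smul_left, ha]; simp
    have hPzero : ∀ w, k + 2 ≤ ℓ w → P (u w) = 0 := fun w hw =>
      (Submodule.starProjection_apply_eq_zero_iff W).2 (horth w hw)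
    have hPself : ∀ v, ℓ v = k → P (u v) = u v := fun v hv =>
      Submodule.starProjection_eq_self_iff.2 (hmemW v hv)
    -- the remainder after peeling level `k`
    set u' : V → E := fun v => u v - P (u v) with hu'
    have hu'zero : ∀ v, ℓ v < k + 1 → u' v = 0 := by
      intro v hv
      rcases Nat.lt_or_ge (ℓ v) k with h | h
      · simp [hu', hu v h]
      · have : ℓ v = k := by omega
        simp [hu', hPself v this]
    have hband' : ∀ v w, ℓ v + 2 ≤ ℓ w → ⟪u' v, u' w⟫_ℝ = 0 := by
      intro v w hvw
      rcases Nat.lt_or_ge (ℓ v) k with h | h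
      · simp [hu', hu v h]
      · have hw : P (u w) = 0 := hPzero w (by omega)
        simp only [hu', hw, sub_zero]
        rw [inner_sub_left, hband v w hvw, Submodule.inner_starProjection_left_eq_right, hw,
          inner_zero_right, sub_zero]
    obtain ⟨p', hp'supp, hp'gram⟩ := ih (k + 1) (by omega) u' hu'zero hband'
    refine ⟨fun j => if j = k then fun v => P (u v) else p' j, ?_, ?_⟩
    · intro j v hj
      by_cases hjk : j = k
      · subst hjk
        simp only [if_true] at hj
        refine ⟨le_rfl, ?_⟩
        rcases Nat.lt_or_ge (ℓ v) j with h | h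
        · exact (hj (by rw [hu v h, map_zero])).elim
        · rcases Nat.lt_or_ge (ℓ v) (j + 2) with h2 | h2
          · omega
          · exact (hj (hPzero v h2)).elim
      · simp only [hjk, if_false] at hj
        obtain ⟨h1, h2⟩ := hp'supp j v hj
        exact ⟨by omega, h2⟩
    · intro v w
      have hk : k ∈ range (L + 1) := by rw [mem_range]; omega
      have hsplit : ∀ v, u v = P (u v) + u' v := fun v => by simp [hu']
      have hcross' : ∀ v w, ⟪u' v, P (u w)⟫_ℝ = 0 := fun v w =>
        Submodule.starProjection_inner_eq_zero _ _ (Submodule.starProjection_apply_mem W _)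
      have hcross : ∀ v w, ⟪P (u v), u' w⟫_ℝ = 0 := fun v w => by
        rw [← real_inner_comm]; exact hcross' w v
      have hp'k : ∀ v, p' k v = 0 := by
        intro v
        by_contra h
        have := (hp'supp k v h).1
        omega
      calc ⟪u v, u w⟫_ℝ = ⟪P (u v), P (u w)⟫_ℝ + ⟪u' v, u' w⟫_ℝ := by
            conv_lhs => rw [hsplit v, hsplit w]
            rw [inner_add_left, inner_add_right, inner_add_right, hcross v w, hcross' v w]
            ring
        _ = ⟪P (u v), P (u w)⟫_ℝ + ∑ j ∈ range (L + 1), ⟪p' j v, p' j w⟫_ℝ := by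
            rw [hp'gram v w]
        _ = ∑ j ∈ range (L + 1), ⟪(if j = k then fun v => P (u v) else p' j) v,
              (if j = k then fun v => P (u v) else p' j) w⟫_ℝ := by
            rw [← Finset.add_sum_erase _ _ hk, ← Finset.add_sum_erase _ _ hk]
            simp only [if_true, hp'k, inner_zero_left, zero_add]
            congr 1
            refine Finset.sum_congr rfl fun j hj => ?_
            rw [mem_erase] at hj
            simp [hj.1]

/-- **Gram peeling along bands.**  If vectors `u_v` carry levels `ℓ v ≤ L` and `u_v ⟂ u_w` whenever
`ℓ w ≥ ℓ v + 2`, then their Gram matrix is a sum over `j` of Gram matrices of families `p_j` supported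
on the two consecutive levels `{j, j+1}` — the positive-semidefinite decomposition along the chordal
"path of cliques" (orthogonal projection onto the span of the lowest level, then induction).
[cite: FawziSaundersonParrilo2016, Thm 4 / §3 (psd matrices sparse w.r.t. a chordal graph decompose along its cliques), App. B (the cliques 𝒯_k ∪ 𝒯_{k+2})] -/
theorem gram_peel (ℓ : V → ℕ) (L : ℕ) (hL : ∀ v, ℓ v ≤ L) (u : V → E)
    (hband : ∀ v w, ℓ v + 2 ≤ ℓ w → ⟪u v, u w⟫_ℝ = 0) :
    ∃ p : ℕ → V → E,
      (∀ j v, p j v ≠ 0 → ℓ v = j ∨ ℓ v = j + 1) ∧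
      ∀ v w, ⟪u v, u w⟫_ℝ = ∑ j ∈ range (L + 1), ⟪p j v, p j w⟫_ℝ := by
  obtain ⟨p, h1, h2⟩ := gram_peel_aux ℓ L hL (L + 1) 0 (by omega) u (fun v h => by omega) hband
  exact ⟨p, fun j v h => (h1 j v h).2, h2⟩

end Peel

/-! ### Part I.b — The Gram vectors `√f · χ_S` and the engine -/

variable {m : ℕ}

/-- **The Gram vectors `u_S = √f · χ_S ∈ ℝ^{{0,1}^m}` of a nonnegative `f` have
`⟨u_S, u_T⟩ = 2^m · f̂(S ∆ T)`**: their Gram matrix is the (scaled) matrix of multiplication by `f` in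
the character basis, positive semidefinite because `f ≥ 0`, with `(S,T)` entry depending on `S ∆ T`
only. [cite: FawziSaundersonParrilo2016, §3 (proof of Thm 1: the matrix of multiplication by f ≥ 0 in the character basis)] -/
theorem inner_sqrt_mul_walsh {f : (Fin m → Bool) → ℝ} (hf : ∀ x, 0 ≤ f x) (S T : Finset (Fin m)) :
    ⟪(WithLp.toLp 2 fun y => Real.sqrt (f y) * walsh S y : EuclideanSpace ℝ (Fin m → Bool)),
      WithLp.toLp 2 fun y => Real.sqrt (f y) * walsh T y⟫_ℝ = 2 ^ m * cubeFourierCoeff f (S ∆ T) := by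
  have h2 : (2 : ℝ) ^ m ≠ 0 := by positivity
  unfold Literature.Computability.Complexity.LowDegree.cubeFourierCoeff
  rw [mul_div_cancel₀ _ h2]
  simp only [PiLp.inner_apply, RCLike.inner_apply, conj_trivial]
  refine sum_congr rfl fun y _ => ?_
  rw [← walsh_mul_walsh]
  have := Real.mul_self_sqrt (hf y)
  calc Real.sqrt (f y) * walsh T y * (Real.sqrt (f y) * walsh S y)
      = (Real.sqrt (f y) * Real.sqrt (f y)) * (walsh S y * walsh T y) := by ring
    _ = f y * (walsh S y * walsh T y) := by rw [this]

/-- `|S ∆ T| + 2|S ∩ T| = |S| + |T|` (plumbing). [folklore] -/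
private theorem card_symmDiff_add (S T : Finset (Fin m)) :
    (S ∆ T).card + 2 * (S ∩ T).card = S.card + T.card := by
  have h1 : S ∆ T = (S ∪ T) \ (S ∩ T) := symmDiff_eq_sup_sdiff_inf S T
  rw [h1, card_sdiff_of_subset (inter_subset_union), ← card_union_add_card_inter S T]
  have : (S ∩ T).card ≤ (S ∪ T).card := card_le_card inter_subset_union
  omega

/-- `|T| ≤ |S| + |S ∆ T|` (plumbing). [folklore] -/
private theorem card_le_card_add_card_symmDiff (S T : Finset (Fin m)) :
    T.card ≤ S.card + (S ∆ T).card := by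
  have h := card_symmDiff_add S T
  have : (S ∩ T).card ≤ S.card := card_le_card inter_subset_left
  omega

/-- `|[m] ∆ S| = m − |S|`. [cite: FawziSaundersonParrilo2016, App. B ("[n] ∆ 𝒞_k = 𝒞_{n−k−2}")] -/
theorem card_univ_symmDiff (S : Finset (Fin m)) : ((univ : Finset (Fin m)) ∆ S).card = m - S.card := by
  have h := card_symmDiff_add (univ : Finset (Fin m)) S
  rw [univ_inter, card_univ, Fintype.card_fin] at h
  omega

/-- `|([m] ∖ {i}) ∆ S| ≤ m + 1 − |S|`. [cite: FawziSaundersonParrilo2016, App. B ("φ([n]) ∆ 𝒞_k ⊆ 𝒯_{n−k−3} ∪ 𝒯_{n−k−1} ∪ 𝒯_{n−k+1}")] -/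
theorem card_univ_erase_symmDiff_le (i : Fin m) (S : Finset (Fin m)) :
    ((univ.erase i) ∆ S).card ≤ m + 1 - S.card := by
  have h := card_symmDiff_add (univ.erase i) S
  rw [card_erase_of_mem (mem_univ i), card_univ, Fintype.card_fin] at h
  have hsub : S.erase i ⊆ univ.erase i ∩ S := by
    intro x hx
    rw [mem_erase] at hx
    exact mem_inter.2 ⟨mem_erase.2 ⟨hx.1, mem_univ x⟩, hx.2⟩
  have h2 := card_le_card hsub
  have h3 : S.card ≤ (S.erase i).card + 1 := by
    by_cases hi : i ∈ S
    · rw [card_erase_add_one hi]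
    · rw [erase_eq_of_notMem hi]; omega
  have h4 : S.card ≤ m := by simpa using card_le_univ S
  omega

/-- **The engine (Fawzi–Saunderson–Parrilo's Theorem 1 for a "path of cliques" by size).**  Let
`f ≥ 0` on `{0,1}^m`, let `𝒱` be a family of subsets and `ℓ` a level function on it such that
(reconstruction) `c · f = Σ_{S,T ∈ 𝒱} χ_S χ_T f̂(S ∆ T)` with `c > 0`, (bands) `f̂(S ∆ T) = 0` whenever
`ℓ T ≥ ℓ S + 2`, and (translation) for every `j` some `R_j ⊆ [m]` has `|R_j ∆ S| ≤ D` for all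
`S ∈ 𝒱` of level `j` or `j + 1`.  Then `f` is a sum of squares of functions of degree `≤ D`.
[cite: FawziSaundersonParrilo2016, Thm 1 (p. 3) / Thm 4 (§3) with Prop. 6 (p. 14) and App. B (pp. 21–22)] -/
theorem hasSosCertificate_of_bandedLevels {D : ℕ} {f : (Fin m → Bool) → ℝ} (hf : ∀ x, 0 ≤ f x)
    (𝒱 : Finset (Finset (Fin m))) (ℓ : Finset (Fin m) → ℕ) {c : ℝ} (hc : 0 < c)
    (hrec : ∀ x, c * f x = ∑ S ∈ 𝒱, ∑ T ∈ 𝒱, walsh S x * walsh T x * cubeFourierCoeff f (S ∆ T))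
    (hband : ∀ S ∈ 𝒱, ∀ T ∈ 𝒱, ℓ S + 2 ≤ ℓ T → cubeFourierCoeff f (S ∆ T) = 0)
    (htrans : ∀ j : ℕ, ∃ R : Finset (Fin m), ∀ S ∈ 𝒱, (ℓ S = j ∨ ℓ S = j + 1) → (R ∆ S).card ≤ D) :
    HasSosCertificate (2 * D) f := by
  classical
  -- Gram vectors on the index type `↥𝒱`, banded by `ℓ`
  set L : ℕ := 𝒱.sup ℓ with hLdef
  have hL : ∀ S : ↥𝒱, ℓ S.1 ≤ L := fun S => Finset.le_sup S.2
  obtain ⟨p, hpsupp, hpgram⟩ := gram_peel (V := ↥𝒱) (fun S => ℓ S.1) L hL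
    (fun S => (WithLp.toLp 2 fun y => Real.sqrt (f y) * walsh S.1 y : EuclideanSpace ℝ (Fin m → Bool)))
    (fun S T hST => by rw [inner_sqrt_mul_walsh hf, hband S.1 S.2 T.1 T.2 hST, mul_zero])
  choose R hR using htrans
  -- the certificate: index `(j, y)`, function `x ↦ κ · Σ_S (p_j S)_y χ_{R_j ∆ S}(x)`
  set κ : ℝ := Real.sqrt (1 / (c * 2 ^ m)) with hκ
  have hκsq : κ ^ 2 * (c * 2 ^ m) = 1 := by
    rw [hκ, Real.sq_sqrt (by positivity)]
    field_simp
  let g : Fin (L + 1) × (Fin m → Bool) → (Fin m → Bool) → ℝ := fun jy x =>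
    κ * ∑ S : ↥𝒱, p jy.1 S jy.2 * walsh (R jy.1 ∆ S.1) x
  refine hasSosCertificate_of_fintype g (fun jy => ?_) (fun x => ?_)
  · -- degree ≤ D = (2D)/2
    rw [Nat.mul_div_cancel_left D two_pos]
    refine HasDegreeLE.const_mul κ (HasDegreeLE.sum _ fun S _ => ?_)
    by_cases hS : p jy.1 S = 0
    · have : (fun x => p jy.1 S jy.2 * walsh (R jy.1 ∆ S.1) x) = fun _ => 0 := by
        funext x; simp [hS]
      rw [this]; exact HasDegreeLE.const D 0
    · exact HasDegreeLE.const_mul _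
        (hasDegreeLE_walsh_of_card_le (hR jy.1 S.1 S.2 (hpsupp jy.1 S hS)))
  · -- the sum of squares is `f`
    have h2 : (2 : ℝ) ^ m ≠ 0 := by positivity
    -- (1) remove the translations: `(Σ a_S χ_{R∆S})² = (Σ a_S χ_S)²`
    have htr : ∀ (j : ℕ) (y : Fin m → Bool),
        (∑ S : ↥𝒱, p j S y * walsh (R j ∆ S.1) x) ^ 2 = (∑ S : ↥𝒱, p j S y * walsh S.1 x) ^ 2 := by
      intro j y
      have : ∑ S : ↥𝒱, p j S y * walsh (R j ∆ S.1) x = walsh (R j) x * ∑ S : ↥𝒱, p j S y * walsh S.1 x := by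
        rw [mul_sum]
        refine sum_congr rfl fun S _ => ?_
        rw [← walsh_mul_walsh]; ring
      rw [this, mul_pow, sq (walsh (R j) x), walsh_mul_self, one_mul]
    -- (2) expand the square over coordinates `y` into the Gram entries of `p_j`
    have hexp : ∀ j : ℕ, ∑ y : Fin m → Bool, (∑ S : ↥𝒱, p j S y * walsh S.1 x) ^ 2 =
        ∑ S : ↥𝒱, ∑ T : ↥𝒱, walsh S.1 x * walsh T.1 x * ⟪p j S, p j T⟫_ℝ := by
      intro j
      have hin : ∀ S T : ↥𝒱, ⟪p j S, p j T⟫_ℝ = ∑ y, p j S y * p j T y := by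
        intro S T; simp [PiLp.inner_apply, mul_comm]
      simp_rw [hin]
      simp_rw [sq, sum_mul_sum, mul_sum]
      rw [sum_comm]
      refine sum_congr rfl fun S _ => ?_
      rw [sum_comm]
      exact sum_congr rfl fun T _ => sum_congr rfl fun y _ => by ring
    -- (3) assemble
    calc f x = κ ^ 2 * (c * 2 ^ m) * f x := by rw [hκsq, one_mul]
      _ = κ ^ 2 * (2 ^ m * (c * f x)) := by ring
      _ = κ ^ 2 * ∑ S : ↥𝒱, ∑ T : ↥𝒱, walsh S.1 x * walsh T.1 x *
            ⟪(WithLp.toLp 2 fun y => Real.sqrt (f y) * walsh S.1 y : EuclideanSpace ℝ (Fin m → Bool)),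
              WithLp.toLp 2 fun y => Real.sqrt (f y) * walsh T.1 y⟫_ℝ := by
          rw [hrec x, mul_sum, ← sum_coe_sort 𝒱]
          congr 1
          refine sum_congr rfl fun S _ => ?_
          rw [mul_sum, ← sum_coe_sort 𝒱]
          exact sum_congr rfl fun T _ => by rw [inner_sqrt_mul_walsh hf]; ring
      _ = κ ^ 2 * ∑ S : ↥𝒱, ∑ T : ↥𝒱, ∑ j ∈ range (L + 1),
            walsh S.1 x * walsh T.1 x * ⟪p j S, p j T⟫_ℝ := by
          congr 1
          exact sum_congr rfl fun S _ => sum_congr rfl fun T _ => by rw [hpgram, mul_sum]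
      _ = κ ^ 2 * ∑ j ∈ range (L + 1), ∑ S : ↥𝒱, ∑ T : ↥𝒱,
            walsh S.1 x * walsh T.1 x * ⟪p j S, p j T⟫_ℝ := by
          congr 1
          rw [sum_congr rfl fun S _ => sum_comm, sum_comm]
      _ = ∑ j : Fin (L + 1), ∑ y : Fin m → Bool, g (j, y) x ^ 2 := by
          simp only [g, mul_pow, htr]
          rw [← Fin.sum_univ_eq_sum_range (fun j => ∑ S : ↥𝒱, ∑ T : ↥𝒱,
            walsh S.1 x * walsh T.1 x * ⟪p j S, p j T⟫_ℝ) (L + 1), mul_sum]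
          refine sum_congr rfl fun j _ => ?_
          rw [← hexp, mul_sum]
      _ = ∑ jy : Fin (L + 1) × (Fin m → Bool), g jy x ^ 2 := by
          rw [Fintype.sum_prod_type]

/-! ### Part I.c — Reconstruction identities `Σ_{S,T} χ_S χ_T f̂(S ∆ T) = |𝒱| · f` -/

/-- Over all pairs: `Σ_{S,T ⊆ [m]} χ_S(x) χ_T(x) f̂(S ∆ T) = 2^m f(x)` (reindex `T ↦ S ∆ T`, Fourier
inversion). [cite: FawziSaundersonParrilo2016, §3 (proof of Thm 1: "Σ_χ |χ|² Σ_s f̂(s) s = |Ĝ| f")] -/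
theorem sum_sum_walsh_mul_cubeFourierCoeff_symmDiff (f : (Fin m → Bool) → ℝ) (x : Fin m → Bool) :
    ∑ S : Finset (Fin m), ∑ T : Finset (Fin m), walsh S x * walsh T x * cubeFourierCoeff f (S ∆ T)
      = 2 ^ m * f x := by
  have hinner : ∀ S : Finset (Fin m),
      ∑ T, walsh S x * walsh T x * cubeFourierCoeff f (S ∆ T) = f x := by
    intro S
    let e : Equiv.Perm (Finset (Fin m)) :=
      Function.Involutive.toPerm (fun T => S ∆ T) fun T => symmDiff_symmDiff_cancel_left S T
    calc ∑ T, walsh S x * walsh T x * cubeFourierCoeff f (S ∆ T)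
        = ∑ T, cubeFourierCoeff f (e T) * walsh (e T) x := by
          refine sum_congr rfl fun T _ => ?_
          show _ = cubeFourierCoeff f (S ∆ T) * walsh (S ∆ T) x
          rw [← walsh_mul_walsh]; ring
      _ = ∑ U, cubeFourierCoeff f U * walsh U x :=
          Equiv.sum_comp e (fun U => cubeFourierCoeff f U * walsh U x)
      _ = f x := sum_cubeFourierCoeff_mul_walsh f x
  simp_rw [hinner]
  simp

/-- On one parity class `𝒱_π = {S ⊆ [m] : |S| ≡ π (mod 2)}` (FSP's connected components
`𝒯_even`, `𝒯_odd` of the half-cube graph), for `f̂` supported on even sets: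
`Σ_{S,T ∈ 𝒱_π} χ_S(x) χ_T(x) f̂(S ∆ T) = |𝒱_π| f(x)` (`T ↦ S ∆ T` maps `𝒱_π` onto the even sets,
then Fourier inversion). [cite: FawziSaundersonParrilo2016, §4.2–4.3 (p. 14: the two components and the automorphism φ)] -/
theorem sum_sum_parity_walsh_mul_cubeFourierCoeff_symmDiff {π : ℕ} (hπ : π < 2)
    (f : (Fin m → Bool) → ℝ) (heven : ∀ S : Finset (Fin m), S.card % 2 = 1 → cubeFourierCoeff f S = 0)
    (x : Fin m → Bool) :
    ∑ S ∈ univ.filter (fun S : Finset (Fin m) => S.card % 2 = π),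
      ∑ T ∈ univ.filter (fun S : Finset (Fin m) => S.card % 2 = π),
        walsh S x * walsh T x * cubeFourierCoeff f (S ∆ T)
      = (univ.filter (fun S : Finset (Fin m) => S.card % 2 = π)).card * f x := by
  set 𝒱 : ℕ → Finset (Finset (Fin m)) := fun π => univ.filter (fun S : Finset (Fin m) => S.card % 2 = π)
    with h𝒱
  have hmem : ∀ (π : ℕ) (S : Finset (Fin m)), S ∈ 𝒱 π ↔ S.card % 2 = π := fun π S => by simp [h𝒱]
  have hinner : ∀ S ∈ 𝒱 π, ∑ T ∈ 𝒱 π, walsh S x * walsh T x * cubeFourierCoeff f (S ∆ T) = f x := by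
    intro S hS
    rw [hmem] at hS
    have hpar : ∀ T : Finset (Fin m), (S ∆ T).card % 2 = (S.card + T.card) % 2 := by
      intro T; have := card_symmDiff_add S T; omega
    calc ∑ T ∈ 𝒱 π, walsh S x * walsh T x * cubeFourierCoeff f (S ∆ T)
        = ∑ U ∈ 𝒱 0, cubeFourierCoeff f U * walsh U x := by
          refine sum_nbij' (fun T => S ∆ T) (fun U => S ∆ U) ?_ ?_ ?_ ?_ ?_
          · intro T hT; rw [hmem] at hT ⊢; rw [hpar]; omega
          · intro U hU; rw [hmem] at hU ⊢; have := hpar U; omega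
          · intro T _; exact symmDiff_symmDiff_cancel_left S T
          · intro U _; exact symmDiff_symmDiff_cancel_left S U
          · intro T _; rw [← walsh_mul_walsh]; ring
      _ = ∑ U, cubeFourierCoeff f U * walsh U x := by
          rw [h𝒱, sum_filter]
          refine sum_congr rfl fun U _ => ?_
          split_ifs with h
          · rfl
          · rw [heven U (by omega), zero_mul]
      _ = f x := sum_cubeFourierCoeff_mul_walsh f x
  show ∑ S ∈ 𝒱 π, ∑ T ∈ 𝒱 π, walsh S x * walsh T x * cubeFourierCoeff f (S ∆ T) = (𝒱 π).card * f x
  rw [sum_congr rfl hinner, sum_const, nsmul_eq_mul]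

end CubeSos

open CubeSos

/-! ### Part II — Laurent's conjecture: Fawzi–Saunderson–Parrilo 2016, Theorem 2 -/

/-- **Fawzi–Saunderson–Parrilo 2016, Theorem 2 (Laurent's conjecture).**  "Any nonnegative quadratic
function on `{−1,1}^n` is a sum-of-squares of polynomials of degree at most `⌈n/2⌉`", where (ibid.
§2, p. 3 and §4.1, p. 14) a quadratic function is one with Fourier support
`𝒮 = {S : |S| = 0 or |S| = 2}` — a quadratic form plus a constant in the `±1` coordinates
`χ_{{i}} = (−1)^{x_i}`.  In the cube currency of this directory: if `f : {0,1}^m → ℝ` is nonnegative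
and `f̂(S) = 0` unless `|S| ∈ {0, 2}`, then `f = Σ_i g_i²` on `{0,1}^m` with every
`deg g_i ≤ ⌈m/2⌉ = (m+1)/2`, i.e. `HasSosCertificate (2⌈m/2⌉) f`.  Proof: the engine on the parity
class `𝒱_π`, `π ≡ ⌈m/2⌉ (mod 2)`, with levels `|S|/2` (cliques `𝒯_k ∪ 𝒯_{k+2}`, `k ≡ ⌈m/2⌉`) and the
translations `∅` (for `k + 2 ≤ ⌈m/2⌉`), `[m]` (`k ≥ ⌈m/2⌉`, `m` even), `[m] ∖ {0}` (`m` odd) of App. B.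
[cite: FawziSaundersonParrilo2016, Thm 2 (p. 3); Prop. 6 (p. 14) and App. B (pp. 21–22)] -/
theorem hasSosCertificate_of_even_quadratic {m : ℕ} (f : (Fin m → Bool) → ℝ) (hf : ∀ x, 0 ≤ f x)
    (hsupp : ∀ S : Finset (Fin m), cubeFourierCoeff f S ≠ 0 → S.card = 0 ∨ S.card = 2) :
    HasSosCertificate (2 * ((m + 1) / 2)) f := by
  classical
  set D := (m + 1) / 2 with hD
  set π := D % 2 with hπ
  have hπ2 : π < 2 := Nat.mod_lt _ two_pos
  have hzero : ∀ S : Finset (Fin m), S.card ≠ 0 → S.card ≠ 2 → cubeFourierCoeff f S = 0 := by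
    intro S h0 h2; by_contra h; rcases hsupp S h with h' | h' <;> contradiction
  -- the parity class `𝒱_π`, nonempty: `∅` if `π = 0`, `{0}` if `π = 1` (then `m ≥ 1`)
  set 𝒱 : Finset (Finset (Fin m)) := univ.filter (fun S : Finset (Fin m) => S.card % 2 = π) with h𝒱
  have hmem : ∀ S : Finset (Fin m), S ∈ 𝒱 ↔ S.card % 2 = π := fun S => by simp [h𝒱]
  have hne : 𝒱.Nonempty := by
    rcases Nat.lt_or_ge π 1 with h | h
    · exact ⟨∅, by rw [hmem, card_empty]; omega⟩
    · have hm : 0 < m := by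
        by_contra hm
        have : m = 0 := by omega
        subst this; simp [hD] at hπ; omega
      exact ⟨{⟨0, hm⟩}, by rw [hmem, card_singleton]; omega⟩
  refine hasSosCertificate_of_bandedLevels hf 𝒱 (fun S => S.card / 2)
    (c := (𝒱.card : ℝ)) (by exact_mod_cast hne.card_pos) (fun x => ?_) ?_ ?_
  · exact (sum_sum_parity_walsh_mul_cubeFourierCoeff_symmDiff hπ2 f
      (fun S hS => hzero S (by omega) (by omega)) x).symm
  · intro S hS T hT hST
    rw [hmem] at hS hT
    have h1 := card_le_card_add_card_symmDiff S T
    have h2 : S.card % 2 = T.card % 2 := by rw [hS, hT]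
    exact hzero _ (by omega) (by omega)
  · intro j
    by_cases hj : 2 * j + π + 2 ≤ D
    · refine ⟨∅, fun S hS hl => ?_⟩
      rw [hmem] at hS
      have : (∅ : Finset (Fin m)) ∆ S = S := by simp [symmDiff_def]
      rw [this]; omega
    · rcases Nat.even_or_odd m with hm | hm
      · refine ⟨univ, fun S hS hl => ?_⟩
        rw [hmem] at hS
        rw [card_univ_symmDiff]
        obtain ⟨a, ha⟩ := hm
        omega
      · obtain ⟨a, ha⟩ := hm
        refine ⟨univ.erase ⟨0, by omega⟩, fun S hS hl => ?_⟩
        rw [hmem] at hS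
        refine (card_univ_erase_symmDiff_le _ S).trans ?_
        omega

/-! ### Part III — All degrees: the Sakaue–Takeda–Kim–Ito bound `⌈(m+r−1)/2⌉` -/

/-- **Sakaue–Takeda–Kim–Ito 2017** (as quoted in [KurpiszLeppanenMastrolilli2016, §1 p. 3 and §3
p. 6] and [Kurpisz2019, Thm 4]): every `f : {0,1}^m → ℝ` of degree `≤ r` which is nonnegative on the
cube is a sum of squares of polynomials of degree `≤ ⌈(m+r−1)/2⌉ = (m+r)/2` on the cube, i.e.
`HasSosCertificate (2⌈(m+r−1)/2⌉) f`.  Proof: the engine on all subsets with levels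
`(|S| + π)/r` (bands of `r` consecutive sizes, shifted by `π ≡ −(D+1) (mod r)` so that no pair of
consecutive bands straddles both `D` and `m − D`) and the translations `∅` / `[m]`; `r = 0` (constant
`f`) directly.  (The original, SIAM J. Optim. 27 (2017) 565–582, is not held by the programme; the
statement is the one quoted verbatim in the two cited sources, whose proof "extends the strategy of"
Fawzi–Saunderson–Parrilo per Slot–Laurent, Math. Program. 2022, §1.4.)
[cite: SakaueEtAl2017, main theorem (as quoted in KurpiszLeppanenMastrolilli2016 §1 p. 3 and Kurpisz2019 Thm 4; original not held, acq-13747)] [cite: KurpiszLeppanenMastrolilli2016, §1 (p. 3) and §3 (p. 6)] [cite: Kurpisz2019, Thm 4] [cite: FawziSaundersonParrilo2016, Thm 1 and App. B (mechanism)] -/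
theorem hasSosCertificate_of_nonneg_of_hasDegreeLE {m r : ℕ} (f : (Fin m → Bool) → ℝ)
    (hf : ∀ x, 0 ≤ f x) (hdeg : HasDegreeLE r f) :
    HasSosCertificate (2 * ((m + r) / 2)) f := by
  classical
  have hzero : ∀ S : Finset (Fin m), r < S.card → cubeFourierCoeff f S = 0 :=
    fun S hS => hdeg.cubeFourierCoeff_eq_zero hS
  rcases Nat.eq_zero_or_pos r with hr | hr
  · -- `r = 0`: `f` is the constant `f̂(∅) ≥ 0`
    subst hr
    have hconst : ∀ x, f x = cubeFourierCoeff f ∅ := by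
      intro x
      rw [← sum_cubeFourierCoeff_mul_walsh f x, Fintype.sum_eq_single ∅]
      · simp
      · intro S hS
        rw [hzero S (by rwa [pos_iff_ne_zero, ne_eq, card_eq_zero]), zero_mul]
    have h0 : 0 ≤ cubeFourierCoeff f ∅ := by
      rcases isEmpty_or_nonempty (Fin m → Bool) with h | ⟨⟨x⟩⟩
      · exact (h.false (fun _ => false)).elim
      · rw [← hconst x]; exact hf x
    refine hasSosCertificate_of_fintype (ι := Unit) (fun _ _ => Real.sqrt (cubeFourierCoeff f ∅))
      (fun _ => HasDegreeLE.const _ _) fun x => ?_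
    rw [Fintype.sum_unique, Real.sq_sqrt h0]
    exact hconst x
  set D := (m + r) / 2 with hD
  set π := r - 1 - D % r with hπ
  have hmod : D % r < r := Nat.mod_lt _ hr
  have hπr : π < r := by omega
  -- `π + D + 1` is a multiple of `r`
  obtain ⟨q, hq⟩ : ∃ q, π + D + 1 = r * q := by
    refine ⟨D / r + 1, ?_⟩
    have := Nat.div_add_mod D r
    rw [mul_add, mul_one]; omega
  refine hasSosCertificate_of_bandedLevels hf univ (fun S => (S.card + π) / r) (c := (2 : ℝ) ^ m)
    (by positivity) (fun x => ?_) ?_ ?_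
  · rw [sum_sum_walsh_mul_cubeFourierCoeff_symmDiff]
  · intro S _ T _ hST
    have h1 := card_le_card_add_card_symmDiff S T
    have hS := Nat.div_add_mod (S.card + π) r
    have hT := Nat.div_add_mod (T.card + π) r
    have hSlt : (S.card + π) % r < r := Nat.mod_lt _ hr
    have hTlt : (T.card + π) % r < r := Nat.mod_lt _ hr
    have : r * ((S.card + π) / r) + 2 * r ≤ r * ((T.card + π) / r) := by
      have := Nat.mul_le_mul_left r hST
      rw [mul_add] at this; linarith
    exact hzero _ (by omega)
  · intro j
    by_cases hj : r * j + 2 * r ≤ D + π + 1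
    · refine ⟨∅, fun S _ hl => ?_⟩
      have : (∅ : Finset (Fin m)) ∆ S = S := by simp [symmDiff_def]
      rw [this]
      have hle : (S.card + π) / r ≤ j + 1 := by omega
      have hlt : S.card + π < (j + 1 + 1) * r := (Nat.div_lt_iff_lt_mul hr).1 (Nat.lt_succ_of_le hle)
      have : (j + 1 + 1) * r = r * j + 2 * r := by ring
      omega
    · refine ⟨univ, fun S _ hl => ?_⟩
      rw [card_univ_symmDiff]
      have hge : j ≤ (S.card + π) / r := by omega
      have hle : r * j ≤ S.card + π := (Nat.le_div_iff_mul_le hr).1 hge |>.trans_eq' (by ring)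
      -- from `r j + 2 r ≥ D + π + 2 = r q + 1` deduce `j + 2 > q`, hence `r (j + 1) ≥ r q`
      have hjq : q < j + 2 := by
        by_contra h
        have : r * (j + 2) ≤ r * q := Nat.mul_le_mul_left r (by omega)
        rw [mul_add] at this; omega
      have hrq : r * q ≤ r * (j + 1) := Nat.mul_le_mul_left r (by omega)
      rw [mul_add, mul_one] at hrq
      have hS : S.card ≤ m := by simpa using card_le_univ S
      omega

/-- **All nonnegative quadratics** (the case `r = 2`): a nonnegative `f : {0,1}^m → ℝ` of degree
`≤ 2` is a sum of squares of polynomials of degree `≤ ⌈(m+1)/2⌉ = ⌊m/2⌋ + 1` on the cube.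
[cite: KurpiszLeppanenMastrolilli2016, §1 (p. 3: "⌈(n+r−1)/2⌉", r = 2)] [cite: FawziSaundersonParrilo2016, Thm 2 (forms) and App. B] -/
theorem hasSosCertificate_of_nonneg_quadratic {m : ℕ} (f : (Fin m → Bool) → ℝ) (hf : ∀ x, 0 ≤ f x)
    (hdeg : HasDegreeLE 2 f) : HasSosCertificate (2 * (m / 2 + 1)) f := by
  have h := hasSosCertificate_of_nonneg_of_hasDegreeLE f hf hdeg
  have : (m + 2) / 2 = m / 2 + 1 := by omega
  rwa [this] at h

/-! ### Part IV — Dual form: the sum-of-squares (Lasserre) relaxation is EXACT at these levels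

The statements above in the form in which Laurent posed the conjecture and in which Sakaue et al. /
Kurpisz–Leppänen–Mastrolilli quote the bound: "the `⌈n/2⌉` level of the Lasserre hierarchy for the cut
polytope is exact" (FSP16 p. 4, the dual point of view of Thm 2) and "the SoS hierarchy requires at most
`⌈(n+r−1)/2⌉` rounds to find the exact optimal value of an unconstrained BPOP of degree `r`" (KLM16 p. 3).
In the pseudo-density language of this directory (`IsPseudoDensity d D`: `E D = 1`, `E D g² ≥ 0` for
`deg g ≤ d/2` — the level-`d/2` Lasserre/SoS relaxation, LRS §2): every valid lower bound `c ≤ f` is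
certified by every pseudo-density of the stated degree, `c ≤ E_x D(x) f(x)`; the relaxation value
`min_D E[D f]` therefore equals `min f` (point masses `2^m·1_{x₀}` are pseudo-densities of every degree). -/

/-- Linearity used below: `E[D (f − c)] = E[D f] − c · E[D]` (plumbing). [folklore] -/
private theorem cubeExpect_mul_sub_const {m : ℕ} (D f : (Fin m → Bool) → ℝ) (c : ℝ) :
    cubeExpect (fun x => D x * (f x - c)) = cubeExpect (fun x => D x * f x) - c * cubeExpect D := by
  unfold cubeExpect
  rw [mul_div_assoc', ← sub_div, Finset.mul_sum, ← Finset.sum_sub_distrib]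
  congr 1
  exact Finset.sum_congr rfl fun x _ => by ring

/-- **Sakaue–Takeda–Kim–Ito 2017, relaxation form: the SoS/Lasserre hierarchy is exact after
`⌈(m+r−1)/2⌉` rounds for degree-`r` objectives on `{0,1}^m`.**  If `deg f ≤ r` and `c ≤ f` on the cube,
then `c ≤ E_x D(x) f(x)` for every pseudo-density `D` of degree `2⌈(m+r−1)/2⌉` ("the SoS hierarchy
requires at most `⌈(n+r−1)/2⌉` rounds to find the exact optimal value of an unconstrained BPOP of
degree `r` with `n` variables").  Weak duality (`IsPseudoDensity.cubeExpect_mul_nonneg`) applied to the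
certificate of `f − c ≥ 0` (`hasSosCertificate_of_nonneg_of_hasDegreeLE`).
[cite: SakaueEtAl2017, main theorem (as quoted in KurpiszLeppanenMastrolilli2016 §1 p. 3 and §3 p. 6)] [cite: KurpiszLeppanenMastrolilli2016, §3 (p. 6)] -/
theorem IsPseudoDensity.le_cubeExpect_mul_of_hasDegreeLE {m r : ℕ} {D f : (Fin m → Bool) → ℝ}
    (hD : IsPseudoDensity (2 * ((m + r) / 2)) D) (hdeg : HasDegreeLE r f) {c : ℝ}
    (hc : ∀ x, c ≤ f x) : c ≤ cubeExpect (fun x => D x * f x) := by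
  have hsos := hasSosCertificate_of_nonneg_of_hasDegreeLE (fun x => f x - c)
    (fun x => sub_nonneg.2 (hc x)) (hdeg.sub (HasDegreeLE.const r c))
  have h0 := hD.cubeExpect_mul_nonneg hsos
  rw [cubeExpect_mul_sub_const, hD.1, mul_one, sub_nonneg] at h0
  exact h0

/-- **Laurent's conjecture, relaxation form (Fawzi–Saunderson–Parrilo 2016, dual of Thm 2): the
`⌈m/2⌉` level of the Lasserre hierarchy is exact for quadratic forms on the cube** (binary quadratic
optimisation / the cut polytope, ibid. §4.1 and "Q_{⌈n/2⌉} = CUT_n", p. 15): if `f̂(S) = 0` unless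
`|S| ∈ {0, 2}` and `c ≤ f` on `{0,1}^m`, then `c ≤ E_x D(x) f(x)` for every pseudo-density `D` of degree
`2⌈m/2⌉`. [cite: FawziSaundersonParrilo2016, Thm 2 (p. 3), §1 p. 4 ("the ⌈n/2⌉ level of the Lasserre hierarchy for the cut polytope is exact") and Cor. 3 (p. 15)] [cite: Laurent2003, the conjecture] -/
theorem IsPseudoDensity.le_cubeExpect_mul_of_even_quadratic {m : ℕ} {D f : (Fin m → Bool) → ℝ}
    (hD : IsPseudoDensity (2 * ((m + 1) / 2)) D)
    (hsupp : ∀ S : Finset (Fin m), cubeFourierCoeff f S ≠ 0 → S.card = 0 ∨ S.card = 2) {c : ℝ}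
    (hc : ∀ x, c ≤ f x) : c ≤ cubeExpect (fun x => D x * f x) := by
  -- `f − c` is again an even quadratic: only the empty coefficient moves
  have hsupp' : ∀ S : Finset (Fin m), cubeFourierCoeff (fun x => f x - c) S ≠ 0 →
      S.card = 0 ∨ S.card = 2 := by
    intro S hS
    by_cases hSe : S = ∅
    · exact Or.inl (by rw [hSe, card_empty])
    · refine hsupp S ?_
      have hconst : cubeFourierCoeff (fun _ : Fin m → Bool => c) S = 0 := by
        unfold Literature.Computability.Complexity.LowDegree.cubeFourierCoeff
        have h := Literature.Computability.Complexity.LowDegree.sum_walsh_mul_walsh_index S (∅ : Finset (Fin m))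
        simp only [walsh_empty, mul_one, if_neg hSe] at h
        rw [← Finset.mul_sum, h, mul_zero, zero_div]
      have hsub : cubeFourierCoeff (fun x => f x - c) S =
          cubeFourierCoeff f S - cubeFourierCoeff (fun _ : Fin m → Bool => c) S := by
        unfold Literature.Computability.Complexity.LowDegree.cubeFourierCoeff
        rw [← sub_div, ← Finset.sum_sub_distrib]
        congr 1
        exact Finset.sum_congr rfl fun x _ => by ring
      rw [hsub, hconst, sub_zero] at hS
      exact hS
  have hsos := hasSosCertificate_of_even_quadratic (fun x => f x - c)
    (fun x => sub_nonneg.2 (hc x)) hsupp'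
  have h0 := hD.cubeExpect_mul_nonneg hsos
  rw [cubeExpect_mul_sub_const, hD.1, mul_one, sub_nonneg] at h0
  exact h0

/-- **Attainment** (the other inequality of "exact"): the scaled point mass `2^m · 1_{x₀}` is a
pseudo-density of every degree and `E[2^m 1_{x₀} · f] = f(x₀)`; so the relaxation value `inf_D E[D f]`
over pseudo-densities of any degree is `≤ min f`, and by the two theorems above it EQUALS `min f` at the
stated levels. [cite: FawziSaundersonParrilo2016, §1 (p. 4, "exact")] [cite: LeeRaghavendraSteurer2015, §2 (pseudo-densities generalise probability densities)] -/
theorem isPseudoDensity_pointMass {m : ℕ} (d : ℕ) (x₀ : Fin m → Bool) :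
    IsPseudoDensity d (fun x : Fin m → Bool => if x = x₀ then (2 : ℝ) ^ m else 0) ∧
      ∀ f : (Fin m → Bool) → ℝ,
        cubeExpect (fun x => (if x = x₀ then (2 : ℝ) ^ m else 0) * f x) = f x₀ := by
  have h2 : (2 : ℝ) ^ m ≠ 0 := by positivity
  have hE : ∀ f : (Fin m → Bool) → ℝ,
      cubeExpect (fun x => (if x = x₀ then (2 : ℝ) ^ m else 0) * f x) = f x₀ := by
    intro f
    unfold cubeExpect
    simp only [ite_mul, zero_mul, Finset.sum_ite_eq', Finset.mem_univ, if_true]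
    field_simp
  refine ⟨⟨?_, fun g _ => ?_⟩, hE⟩
  · simpa using hE (fun _ => 1)
  · rw [hE]; positivity

/-! ### Part V — Matrix-valued functions: the same thresholds hold for GRAM factorisations, uniformly in the matrix size

Fawzi–Saunderson–Parrilo's proof of their Theorem 1 (and hence of Theorem 2) goes through verbatim for a
positive-semidefinite-MATRIX-valued `F : {0,1}^m → 𝕊^r_+` in place of `f ≥ 0`: the Gram vectors become
`u_{(S,a)} = F^{1/2} e_a · χ_S ∈ ℝ^{{0,1}^m × [r]}` with `⟨u_{(S,a)}, u_{(T,c)}⟩ = 2^m F̂_{ac}(S ∆ T)`,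
banded by `|S|` as before, and the peeled pieces read in coordinates give `F(x) = G(x) G(x)ᵀ` with every
ENTRY of `G` of degree `≤ D`.  (Matrix-valued reading, ours — the sources state the scalar case; the
engine below is the scalar engine with an extra index.  This is the form in which the `pnp-psdrank` cell
consumes it: Gram factors `B_U` of low Johnson degree, `IsLowDegreeU`, r-uniformly.) -/

namespace CubeSos

variable {m : ℕ}

/-- **Matrix engine** (the engine `hasSosCertificate_of_bandedLevels` with a matrix index): for
`F : {0,1}^m → Matrix r r` pointwise positive semidefinite, with entrywise reconstruction on `𝒱`, bands
and translations as in the scalar engine, there is `G : {0,1}^m → ℝ^{r × J}` with all entries of degree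
`≤ D` and `F(x) = G(x) G(x)ᵀ` on the cube. [cite: FawziSaundersonParrilo2016, Thm 1 (p. 3) / Thm 4 (§3) with App. B — matrix-valued reading (ours)] -/
theorem gramFactorization_of_bandedLevels {r D : ℕ} {F : (Fin m → Bool) → Matrix (Fin r) (Fin r) ℝ}
    (hF : ∀ x, (F x).PosSemidef)
    (𝒱 : Finset (Finset (Fin m))) (ℓ : Finset (Fin m) → ℕ) {c : ℝ} (hc : 0 < c)
    (hrec : ∀ x a b, c * F x a b =
      ∑ S ∈ 𝒱, ∑ T ∈ 𝒱, walsh S x * walsh T x * cubeFourierCoeff (fun y => F y a b) (S ∆ T))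
    (hband : ∀ S ∈ 𝒱, ∀ T ∈ 𝒱, ℓ S + 2 ≤ ℓ T → ∀ a b, cubeFourierCoeff (fun y => F y a b) (S ∆ T) = 0)
    (htrans : ∀ j : ℕ, ∃ R : Finset (Fin m), ∀ S ∈ 𝒱, (ℓ S = j ∨ ℓ S = j + 1) → (R ∆ S).card ≤ D) :
    ∃ (J : ℕ) (G : (Fin m → Bool) → Matrix (Fin r) (Fin J) ℝ),
      (∀ a j, HasDegreeLE D (fun x => G x a j)) ∧ ∀ x, F x = G x * (G x)ᵀ := by
  classical
  -- pointwise psd square roots `F = Q * Q`, `Qᴴ = Q`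
  set Q : (Fin m → Bool) → Matrix (Fin r) (Fin r) ℝ := fun y => CFC.sqrt (F y) with hQ
  have hQQ : ∀ y, Q y * Q y = F y := fun y => CFC.sqrt_mul_sqrt_self (F y) (hF y).nonneg
  have hQH : ∀ y, (Q y)ᴴ = Q y := fun y => ((CFC.sqrt_nonneg (F y)).posSemidef).1
  have hQsymm : ∀ y a b, Q y a b = Q y b a := by
    intro y a b
    have := congrFun (congrFun (hQH y) a) b
    rw [conjTranspose_apply, star_trivial] at this
    exact this.symm
  have hFentry : ∀ y a b, F y a b = ∑ e, Q y e a * Q y e b := by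
    intro y a b
    rw [← hQQ y, Matrix.mul_apply]
    exact sum_congr rfl fun e _ => by rw [hQsymm y a e]
  -- Gram vectors indexed by `↥𝒱 × Fin r`, coordinates `(y, e)`
  have h2 : (2 : ℝ) ^ m ≠ 0 := by positivity
  let u : ↥𝒱 × Fin r → EuclideanSpace ℝ ((Fin m → Bool) × Fin r) := fun Sa =>
    WithLp.toLp 2 fun ye => Q ye.1 ye.2 Sa.2 * walsh Sa.1.1 ye.1
  have hinner : ∀ Sa Tb : ↥𝒱 × Fin r, ⟪u Sa, u Tb⟫_ℝ =
      2 ^ m * cubeFourierCoeff (fun y => F y Sa.2 Tb.2) (Sa.1.1 ∆ Tb.1.1) := by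
    intro Sa Tb
    unfold Literature.Computability.Complexity.LowDegree.cubeFourierCoeff
    rw [mul_div_cancel₀ _ h2]
    simp only [u, PiLp.inner_apply, RCLike.inner_apply, conj_trivial]
    rw [Fintype.sum_prod_type]
    refine sum_congr rfl fun y _ => ?_
    rw [hFentry, ← walsh_mul_walsh, sum_mul]
    exact sum_congr rfl fun e _ => by ring
  set L : ℕ := 𝒱.sup ℓ with hLdef
  have hL : ∀ Sa : ↥𝒱 × Fin r, ℓ Sa.1.1 ≤ L := fun Sa => Finset.le_sup Sa.1.2
  obtain ⟨p, hpsupp, hpgram⟩ := gram_peel (V := ↥𝒱 × Fin r) (fun Sa => ℓ Sa.1.1) L hL u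
    (fun Sa Tb hST => by
      rw [hinner, hband Sa.1.1 Sa.1.2 Tb.1.1 Tb.1.2 hST Sa.2 Tb.2, mul_zero])
  choose R hR using htrans
  set κ : ℝ := Real.sqrt (1 / (c * 2 ^ m)) with hκ
  have hκsq : κ ^ 2 * (c * 2 ^ m) = 1 := by
    rw [hκ, Real.sq_sqrt (by positivity)]
    field_simp
  -- columns indexed by `ι = Fin (L+1) × ((Fin m → Bool) × Fin r)`, then reindexed by `Fin J`
  let ι := Fin (L + 1) × ((Fin m → Bool) × Fin r)
  let G₀ : (Fin m → Bool) → Matrix (Fin r) ι ℝ := fun x => Matrix.of fun a jye =>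
    κ * ∑ S : ↥𝒱, p jye.1 (S, a) jye.2 * walsh (R jye.1 ∆ S.1) x
  let e : ι ≃ Fin (Fintype.card ι) := Fintype.equivFin ι
  refine ⟨Fintype.card ι, fun x => (G₀ x).submatrix id e.symm, fun a j => ?_, fun x => ?_⟩
  · -- degrees
    simp only [G₀, Matrix.submatrix_apply, Matrix.of_apply, id]
    refine HasDegreeLE.const_mul κ (HasDegreeLE.sum _ fun S _ => ?_)
    by_cases hS : p (e.symm j).1 (S, a) = 0
    · have : (fun x => p (e.symm j).1 (S, a) (e.symm j).2 * walsh (R (e.symm j).1 ∆ S.1) x) =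
          fun _ => 0 := by funext x; simp [hS]
      rw [this]; exact HasDegreeLE.const D 0
    · exact HasDegreeLE.const_mul _
        (hasDegreeLE_walsh_of_card_le (hR (e.symm j).1 S.1 S.2 (hpsupp _ (S, a) hS)))
  · -- `F x = G x G xᵀ`
    ext a b
    have hre : ((G₀ x).submatrix id e.symm * ((G₀ x).submatrix id e.symm)ᵀ) a b =
        ∑ i : ι, G₀ x a i * G₀ x b i := by
      rw [Matrix.mul_apply]
      exact Equiv.sum_comp e.symm (fun i : ι => G₀ x a i * G₀ x b i)
    rw [hre]
    -- (1) translations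
    have htr : ∀ (j : ℕ) (ye : (Fin m → Bool) × Fin r) (a b : Fin r),
        (∑ S : ↥𝒱, p j (S, a) ye * walsh (R j ∆ S.1) x) * (∑ S : ↥𝒱, p j (S, b) ye * walsh (R j ∆ S.1) x)
          = (∑ S : ↥𝒱, p j (S, a) ye * walsh S.1 x) * (∑ S : ↥𝒱, p j (S, b) ye * walsh S.1 x) := by
      intro j ye a b
      have hfac : ∀ a' : Fin r, ∑ S : ↥𝒱, p j (S, a') ye * walsh (R j ∆ S.1) x =
          walsh (R j) x * ∑ S : ↥𝒱, p j (S, a') ye * walsh S.1 x := by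
        intro a'
        rw [mul_sum]
        refine sum_congr rfl fun S _ => ?_
        rw [← walsh_mul_walsh]; ring
      rw [hfac a, hfac b]
      calc walsh (R j) x * (∑ S : ↥𝒱, p j (S, a) ye * walsh S.1 x) *
            (walsh (R j) x * ∑ S : ↥𝒱, p j (S, b) ye * walsh S.1 x)
          = (walsh (R j) x * walsh (R j) x) * ((∑ S : ↥𝒱, p j (S, a) ye * walsh S.1 x) *
              ∑ S : ↥𝒱, p j (S, b) ye * walsh S.1 x) := by ring
        _ = _ := by rw [walsh_mul_self, one_mul]
    -- (2) coordinates ↦ Gram entries of `p_j`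
    have hexp : ∀ j : ℕ, ∑ ye : (Fin m → Bool) × Fin r,
        (∑ S : ↥𝒱, p j (S, a) ye * walsh S.1 x) * (∑ S : ↥𝒱, p j (S, b) ye * walsh S.1 x) =
        ∑ S : ↥𝒱, ∑ T : ↥𝒱, walsh S.1 x * walsh T.1 x * ⟪p j (S, a), p j (T, b)⟫_ℝ := by
      intro j
      have hin : ∀ S T : ↥𝒱, ⟪p j (S, a), p j (T, b)⟫_ℝ = ∑ ye, p j (S, a) ye * p j (T, b) ye := by
        intro S T; simp [PiLp.inner_apply, mul_comm]
      simp_rw [hin]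
      simp_rw [sum_mul_sum, mul_sum]
      rw [sum_comm]
      refine sum_congr rfl fun S _ => ?_
      rw [sum_comm]
      exact sum_congr rfl fun T _ => sum_congr rfl fun y _ => by ring
    -- (3) assemble
    calc F x a b = κ ^ 2 * (c * 2 ^ m) * F x a b := by rw [hκsq, one_mul]
      _ = κ ^ 2 * (2 ^ m * (c * F x a b)) := by ring
      _ = κ ^ 2 * ∑ S : ↥𝒱, ∑ T : ↥𝒱, walsh S.1 x * walsh T.1 x * ⟪u (S, a), u (T, b)⟫_ℝ := by
          rw [hrec x a b, mul_sum, ← sum_coe_sort 𝒱]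
          congr 1
          refine sum_congr rfl fun S _ => ?_
          rw [mul_sum, ← sum_coe_sort 𝒱]
          exact sum_congr rfl fun T _ => by rw [hinner]; ring
      _ = κ ^ 2 * ∑ S : ↥𝒱, ∑ T : ↥𝒱, ∑ j ∈ range (L + 1),
            walsh S.1 x * walsh T.1 x * ⟪p j (S, a), p j (T, b)⟫_ℝ := by
          congr 1
          exact sum_congr rfl fun S _ => sum_congr rfl fun T _ => by rw [hpgram, mul_sum]
      _ = κ ^ 2 * ∑ j ∈ range (L + 1), ∑ S : ↥𝒱, ∑ T : ↥𝒱,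
            walsh S.1 x * walsh T.1 x * ⟪p j (S, a), p j (T, b)⟫_ℝ := by
          congr 1
          rw [sum_congr rfl fun S _ => sum_comm, sum_comm]
      _ = ∑ j : Fin (L + 1), ∑ ye : (Fin m → Bool) × Fin r, G₀ x a (j, ye) * G₀ x b (j, ye) := by
          rw [← Fin.sum_univ_eq_sum_range (fun j => ∑ S : ↥𝒱, ∑ T : ↥𝒱,
            walsh S.1 x * walsh T.1 x * ⟪p j (S, a), p j (T, b)⟫_ℝ) (L + 1), mul_sum]
          refine sum_congr rfl fun j _ => ?_
          rw [← hexp, mul_sum]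
          refine sum_congr rfl fun ye _ => ?_
          rw [← htr]
          simp only [G₀, Matrix.of_apply]
          ring
      _ = ∑ i : ι, G₀ x a i * G₀ x b i := by
          rw [Fintype.sum_prod_type]

/-- Entrywise reconstruction over all pairs (matrix form of
`sum_sum_walsh_mul_cubeFourierCoeff_symmDiff`). [cite: FawziSaundersonParrilo2016, §3 (proof of Thm 1)] -/
theorem sum_sum_walsh_mul_cubeFourierCoeff_symmDiff_entry {r : ℕ}
    (F : (Fin m → Bool) → Matrix (Fin r) (Fin r) ℝ) (x : Fin m → Bool) (a b : Fin r) :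
    (2 : ℝ) ^ m * F x a b = ∑ S : Finset (Fin m), ∑ T : Finset (Fin m),
      walsh S x * walsh T x * cubeFourierCoeff (fun y => F y a b) (S ∆ T) :=
  (sum_sum_walsh_mul_cubeFourierCoeff_symmDiff (fun y => F y a b) x).symm

end CubeSos

/-- **Matrix-valued Sakaue–Takeda–Kim–Ito: psd-matrix-valued functions of degree `≤ d` on `{0,1}^m`
have Gram factorisations of degree `⌈(m+d−1)/2⌉`, uniformly in the matrix size.**  If
`F : {0,1}^m → ℝ^{r×r}` is positive semidefinite at every point and every entry has degree `≤ d`, then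
`F(x) = G(x) G(x)ᵀ` on the cube for some `G : {0,1}^m → ℝ^{r×J}` all of whose entries have degree
`≤ (m+d)/2 = ⌈(m+d−1)/2⌉` (`r = 1` is `hasSosCertificate_of_nonneg_of_hasDegreeLE`).  Same proof: bands of
`d` consecutive sizes shifted by `π ≡ −(D+1) (mod d)`, translations `∅` / `[m]`.
[cite: SakaueEtAl2017, main theorem (as quoted in KurpiszLeppanenMastrolilli2016 §1 p. 3) — matrix-valued reading (ours)] [cite: FawziSaundersonParrilo2016, Thm 1 and App. B (mechanism)] -/
theorem gramFactorization_of_psd_of_hasDegreeLE {m r d : ℕ}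
    (F : (Fin m → Bool) → Matrix (Fin r) (Fin r) ℝ) (hF : ∀ x, (F x).PosSemidef)
    (hdeg : ∀ a b, HasDegreeLE d (fun x => F x a b)) :
    ∃ (J : ℕ) (G : (Fin m → Bool) → Matrix (Fin r) (Fin J) ℝ),
      (∀ a j, HasDegreeLE ((m + d) / 2) (fun x => G x a j)) ∧ ∀ x, F x = G x * (G x)ᵀ := by
  classical
  have hzero : ∀ a b (S : Finset (Fin m)), d < S.card → cubeFourierCoeff (fun x => F x a b) S = 0 :=
    fun a b S hS => (hdeg a b).cubeFourierCoeff_eq_zero hS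
  rcases Nat.eq_zero_or_pos d with hd | hd
  · -- `d = 0`: `F` is constant, equal to the psd matrix `F̂(∅)`; one square root does it
    subst hd
    have hconst : ∀ x a b, F x a b = cubeFourierCoeff (fun y => F y a b) ∅ := by
      intro x a b
      rw [← sum_cubeFourierCoeff_mul_walsh (fun y => F y a b) x, Fintype.sum_eq_single ∅]
      · simp
      · intro S hS
        rw [hzero a b S (by rwa [pos_iff_ne_zero, ne_eq, card_eq_zero]), zero_mul]
    rcases isEmpty_or_nonempty (Fin m → Bool) with h | ⟨⟨x₀⟩⟩
    · exact (h.false (fun _ => false)).elim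
    have hFx : ∀ x, F x = F x₀ := fun x => by
      ext a b; rw [hconst x a b, hconst x₀ a b]
    set Q := CFC.sqrt (F x₀) with hQ
    have hQQ : Q * Q = F x₀ := CFC.sqrt_mul_sqrt_self (F x₀) (hF x₀).nonneg
    have hQH : Qᴴ = Q := ((CFC.sqrt_nonneg (F x₀)).posSemidef).1
    have hQT : Qᵀ = Q := by rw [← conjTranspose_eq_transpose_of_trivial]; exact hQH
    refine ⟨r, fun _ => Q, fun a j => HasDegreeLE.const _ _, fun x => ?_⟩
    show F x = Q * Qᵀ
    rw [hQT, hQQ, hFx x]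
  set D := (m + d) / 2 with hD
  set π := d - 1 - D % d with hπ
  have hmod : D % d < d := Nat.mod_lt _ hd
  have hπd : π < d := by omega
  obtain ⟨q, hq⟩ : ∃ q, π + D + 1 = d * q := by
    refine ⟨D / d + 1, ?_⟩
    have := Nat.div_add_mod D d
    rw [mul_add, mul_one]; omega
  refine CubeSos.gramFactorization_of_bandedLevels hF univ (fun S => (S.card + π) / d)
    (c := (2 : ℝ) ^ m) (by positivity) (fun x a b => ?_) ?_ ?_
  · exact CubeSos.sum_sum_walsh_mul_cubeFourierCoeff_symmDiff_entry F x a b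
  · intro S _ T _ hST a b
    have h1 := CubeSos.card_le_card_add_card_symmDiff S T
    have hS := Nat.div_add_mod (S.card + π) d
    have hT := Nat.div_add_mod (T.card + π) d
    have hSlt : (S.card + π) % d < d := Nat.mod_lt _ hd
    have hTlt : (T.card + π) % d < d := Nat.mod_lt _ hd
    have : d * ((S.card + π) / d) + 2 * d ≤ d * ((T.card + π) / d) := by
      have := Nat.mul_le_mul_left d hST
      rw [mul_add] at this; linarith
    exact hzero a b _ (by omega)
  · intro j
    by_cases hj : d * j + 2 * d ≤ D + π + 1
    · refine ⟨∅, fun S _ hl => ?_⟩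
      have : (∅ : Finset (Fin m)) ∆ S = S := by simp [symmDiff_def]
      rw [this]
      have hle : (S.card + π) / d ≤ j + 1 := by omega
      have hlt : S.card + π < (j + 1 + 1) * d := (Nat.div_lt_iff_lt_mul hd).1 (Nat.lt_succ_of_le hle)
      have : (j + 1 + 1) * d = d * j + 2 * d := by ring
      omega
    · refine ⟨univ, fun S _ hl => ?_⟩
      rw [CubeSos.card_univ_symmDiff]
      have hge : j ≤ (S.card + π) / d := by omega
      have hle : d * j ≤ S.card + π := (Nat.le_div_iff_mul_le hd).1 hge |>.trans_eq' (by ring)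
      have hjq : q < j + 2 := by
        by_contra h
        have : d * (j + 2) ≤ d * q := Nat.mul_le_mul_left d (by omega)
        rw [mul_add] at this; omega
      have hrq : d * q ≤ d * (j + 1) := Nat.mul_le_mul_left d (by omega)
      rw [mul_add, mul_one] at hrq
      have hS : S.card ≤ m := by simpa using card_le_univ S
      omega

/-- **Matrix-valued Laurent/FSP: psd fields whose entries are quadratic forms in the `±1` coordinates
have Gram factorisations of degree `⌈m/2⌉`, uniformly in the matrix size.**  If every entry of the
pointwise-psd `F : {0,1}^m → ℝ^{r×r}` has Fourier support in `{|S| ∈ {0,2}}`, then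
`F(x) = G(x) G(x)ᵀ` with all entries of `G` of degree `≤ (m+1)/2` (`r = 1` is
`hasSosCertificate_of_even_quadratic`).
[cite: FawziSaundersonParrilo2016, Thm 2 (p. 3), Prop. 6 and App. B — matrix-valued reading (ours)] -/
theorem gramFactorization_of_psd_even_quadratic {m r : ℕ}
    (F : (Fin m → Bool) → Matrix (Fin r) (Fin r) ℝ) (hF : ∀ x, (F x).PosSemidef)
    (hsupp : ∀ a b (S : Finset (Fin m)), cubeFourierCoeff (fun x => F x a b) S ≠ 0 →
      S.card = 0 ∨ S.card = 2) :
    ∃ (J : ℕ) (G : (Fin m → Bool) → Matrix (Fin r) (Fin J) ℝ),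
      (∀ a j, HasDegreeLE ((m + 1) / 2) (fun x => G x a j)) ∧ ∀ x, F x = G x * (G x)ᵀ := by
  classical
  set D := (m + 1) / 2 with hD
  set π := D % 2 with hπ
  have hπ2 : π < 2 := Nat.mod_lt _ two_pos
  have hzero : ∀ a b (S : Finset (Fin m)), S.card ≠ 0 → S.card ≠ 2 →
      cubeFourierCoeff (fun x => F x a b) S = 0 := by
    intro a b S h0 h2; by_contra h; rcases hsupp a b S h with h' | h' <;> contradiction
  set 𝒱 : Finset (Finset (Fin m)) := univ.filter (fun S : Finset (Fin m) => S.card % 2 = π) with h𝒱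
  have hmem : ∀ S : Finset (Fin m), S ∈ 𝒱 ↔ S.card % 2 = π := fun S => by simp [h𝒱]
  have hne : 𝒱.Nonempty := by
    rcases Nat.lt_or_ge π 1 with h | h
    · exact ⟨∅, by rw [hmem, card_empty]; omega⟩
    · have hm : 0 < m := by
        by_contra hm
        have : m = 0 := by omega
        subst this; simp [hD] at hπ; omega
      exact ⟨{⟨0, hm⟩}, by rw [hmem, card_singleton]; omega⟩
  refine CubeSos.gramFactorization_of_bandedLevels hF 𝒱 (fun S => S.card / 2)
    (c := (𝒱.card : ℝ)) (by exact_mod_cast hne.card_pos) (fun x a b => ?_) ?_ ?_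
  · exact (CubeSos.sum_sum_parity_walsh_mul_cubeFourierCoeff_symmDiff hπ2 (fun y => F y a b)
      (fun S hS => hzero a b S (by omega) (by omega)) x).symm
  · intro S hS T hT hST a b
    rw [hmem] at hS hT
    have h1 := CubeSos.card_le_card_add_card_symmDiff S T
    have h2 : S.card % 2 = T.card % 2 := by rw [hS, hT]
    exact hzero a b _ (by omega) (by omega)
  · intro j
    by_cases hj : 2 * j + π + 2 ≤ D
    · refine ⟨∅, fun S hS hl => ?_⟩
      rw [hmem] at hS
      have : (∅ : Finset (Fin m)) ∆ S = S := by simp [symmDiff_def]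
      rw [this]; omega
    · rcases Nat.even_or_odd m with hm | hm
      · refine ⟨univ, fun S hS hl => ?_⟩
        rw [hmem] at hS
        rw [CubeSos.card_univ_symmDiff]
        obtain ⟨a, ha⟩ := hm
        omega
      · obtain ⟨a, ha⟩ := hm
        refine ⟨univ.erase ⟨0, by omega⟩, fun S hS hl => ?_⟩
        rw [hmem] at hS
        refine (CubeSos.card_univ_erase_symmDiff_le _ S).trans ?_
        omega

end Literature.Combinatorics.Optimization
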